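import Summits.QuantumFields.YangMills.Theorems.UnitScaleTiltProp8FlatScalarExtension
import HarnessLib

/-!
# K0⁷ STUB 1 (`stub_prop8StepCoP13`), sub-target S4b «the (δ∕δA′)V pieces at objects», brick 11 (junction lemma for the capstone's transpose letters):
# **TRANSPOSES OF COMPONENTWISE EXTENSIONS FOR THE TRACE PAIRINGS** — for a real scalar operator `g` (kernel `g(e_i)(b)`) and its componentwise `𝔤ᶜ`-extension
# `G_V` (UST `FlatScalarExtension.exists_extension`; k0-s1-w1's `Q_V, H_V, Δ_{a,V}, G̃_V` of p595460), the extension `Gᵗ_V` of the TRANSPOSED kernel is the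
# transpose of `G_V` for every pair of trace pairings `Σ_i μ·τ(Y_i δ_i)`, `Σ_b ν·τ(X_b X′_b)` (print's (27)∕(66): `⟨A, J⟩ = Σ_b η^d tr A(b)J(b)`), and a
# SYMMETRIC real kernel extends to a pairing-symmetric operator — the adjunction identities `hQt`, `hHt`, `hM` of `K0Stub1SectFWSlotOneLevel.exists_sectF_W_oneLevel`
# for the operators of record

Cell `pub-ymgap`, width seat `pub-ymgap-k0-s1-w2` g2 (director-ym №197 ∕ HUMAN RULING D-0149; plan g77–g81 W-SEAT-START-LIST §k0-s1, w2 ↦ S4b).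
`--kind proof --supports stmt-QuantumFields-20541 --as helper`; count-neutral.  [15] = [Balaban1985Variational].

WHY.  The capstone `exists_sectF_W_oneLevel ∕ _levOf` (brick 10) takes print's `Q*`, `H*` (and `𝔇(A′)*`) as continuous linear maps DISPLAYED by their adjunction
identities for the pairing (27) on fine fields and a pairing `B` on block data, and the multiplier `M = (QGQ*)⁻¹ − a` as a `B`-symmetric map.  At the record these
operators are the componentwise extensions of lit-balaban's real flat operators (k0-s1-w1 g2 `…K0Stub1Eq158FlatOpsMatrixFields.exists_extensions_flatOps`: p. 288
«we have suppressed matrix indices of operators acting on the Lie algebra valued functions»).  THIS FILE supplies the three identities generically: (i) the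
extension of the transposed kernel EXISTS (same packaging as UST's `exists_extension`); (ii) it is the transpose for ANY trace functional `τ` and volume factors
`μ, ν` (scaled by `ν∕μ`); (iii) a kernel symmetric as a real matrix extends to a `B`-symmetric operator for the unweighted block pairing — so `M_V` (extension of
`EE D − aE D w`, symmetric for the Euclidean structure of `BondIdxSpace D`: UST `FlatCubeOperators.inner_EE_left`, lit-balaban `inner_aE_left`) qualifies.

WHAT IS PROVED (sorry-free; no definition; axioms standard).  `ι`, `κ` finite index types; `W` any `ℂ`-module (the fibre `𝔤ᶜ`); `𝔸` a `ℂ`-algebra with a linear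
functional `τ` for the pairing statements.
* §1 `exists_transposeExtension` — `∃ Gt : (κ → W) →ₗ[ℂ] (ι → W), Gt X i = Σ_b g(e_i)(b)·X b` (the extension of the transposed kernel of `g : (ι → ℝ) →ₗ[ℝ] (κ → ℝ)`).
* §2 ★ `sum_pair_transposeExtension` — `Σ_i τ((Gt X)_i · δ_i) = Σ_b τ(X_b · (G_V δ)_b)` (unweighted); ★ `pair_transposeExtension_weighted` — with volume factors:
  `μ·Σ_i τ(((ν∕μ)•Gt X)_i δ_i) = ν·Σ_b τ(X_b (G_V δ)_b)` (`μ ≠ 0`) — the shape `BE (Qt X) δ = B X (Q δ)` of the capstone with `BE = μ·Σ τ(··)`, `B = ν·Σ τ(··)`.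
* §3 ★ `sum_pair_extension_symm` — if the real kernel is symmetric (`g(e_i)(i′) = g(e_{i′})(i)`), then `Σ_i τ((G_V X)_i X′_i) = Σ_i τ(X_i (G_V X′)_i)` (the `hM` shape).
* §4 `kernel_symm_of_inner_symm` — a real operator symmetric for the Euclidean inner product of `EuclideanSpace ℝ ι` read through `WithLp` has a symmetric kernel
  (the form in which lit-balaban ∕ UST state the symmetry of `(QGQ*)⁻¹` and `a`).
HONEST SCOPE.  Finite-sum algebra; nothing of [15] asserted; the identification of the capstone's `BE` with `bondPair` read on `PBond P 0` (a reindexing `(x, μ) ↔ ⟨x, μ⟩`)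
and the choice of block volume factors are the instantiator's (S1∕S6 junction); `stub_prop8StepCoP13` ∕ K0⁷ NOT closed; N07 NOT discharged; counts unmoved (28∕28 · 5∕27);
one finite 𝕋⁴ programme at fixed ε — R4 closes the conditional finite-𝕋⁴ rung `BalabanLadder.UV` only, never the summit; the YM mass gap (Clay) is NOT proved by any
of this; nothing continuum ∕ ℝ⁴ ∕ OS.  No `sorry`, no `def`, no `instance`, no `notation`.

References: [15] (27) p.282, (66) p.287, (88) p.291, p.288.
-/

set_option autoImplicit false

noncomputable section

namespace Summit.QuantumFields.YangMills.Theorems.K0Stub1ExtensionTransposes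

open scoped BigOperators

/-! ## §1  The extension of the transposed kernel -/

section Transpose

variable {ι κ : Type*} [Fintype κ] [DecidableEq ι]

/-- **THE EXTENSION OF THE TRANSPOSED KERNEL EXISTS**: for a real scalar operator `g` with kernel `g(e_i)(b)`, the ℂ-linear map `(Gᵗ_V X)(i) = Σ_b g(e_i)(b)·X(b)` on
`W`-valued block data (UST `FlatScalarExtension.exists_extension` with the indices swapped) — print's `Q*`, `H*` «with matrix indices suppressed».
[cite: Balaban1985Variational, p.288, (66) p.287] -/
theorem exists_transposeExtension (g : (ι → ℝ) →ₗ[ℝ] (κ → ℝ)) (W : Type*) [AddCommGroup W] [Module ℂ W] :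
    ∃ Gt : (κ → W) →ₗ[ℂ] (ι → W), ∀ (X : κ → W) (i : ι), Gt X i = ∑ b, ((g (Pi.single i 1) b : ℝ) : ℂ) • X b :=
  ⟨{ toFun := fun X i => ∑ b, ((g (Pi.single i 1) b : ℝ) : ℂ) • X b
     map_add' := fun X Y => by
       funext i; simp only [Pi.add_apply, smul_add, Finset.sum_add_distrib]
     map_smul' := fun z X => by
       funext i; simp only [Pi.smul_apply, RingHom.id_apply, Finset.smul_sum, smul_smul, mul_comm z] },
    fun _ _ => rfl⟩

end Transpose

/-! ## §2  The transpose identity for trace pairings -/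

section Pairing

variable {ι κ : Type*} [Fintype ι] [Fintype κ] [DecidableEq ι]
variable {𝔸 : Type*} [Ring 𝔸] [Algebra ℂ 𝔸] (τ : 𝔸 →ₗ[ℂ] ℂ)

/-- ★ **`Gᵗ_V` IS THE TRANSPOSE OF `G_V` FOR THE TRACE PAIRINGS** (unweighted): `Σ_i τ((Gᵗ_V X)_i · δ_i) = Σ_b τ(X_b · (G_V δ)_b)` for every linear functional `τ`
(no traciality needed: the kernel entries are scalars). [cite: Balaban1985Variational, (66) p.287, (88) p.291] -/
theorem sum_pair_transposeExtension (g : (ι → ℝ) →ₗ[ℝ] (κ → ℝ)) {Gv : (ι → 𝔸) →ₗ[ℂ] (κ → 𝔸)} {Gt : (κ → 𝔸) →ₗ[ℂ] (ι → 𝔸)}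
    (hGv : ∀ (A : ι → 𝔸) (b : κ), Gv A b = ∑ i, ((g (Pi.single i 1) b : ℝ) : ℂ) • A i)
    (hGt : ∀ (X : κ → 𝔸) (i : ι), Gt X i = ∑ b, ((g (Pi.single i 1) b : ℝ) : ℂ) • X b) (X : κ → 𝔸) (δ : ι → 𝔸) :
    ∑ i, τ (Gt X i * δ i) = ∑ b, τ (X b * Gv δ b) := by
  simp_rw [hGt, hGv, Finset.sum_mul, Finset.mul_sum, map_sum, smul_mul_assoc, mul_smul_comm, map_smul]
  rw [Finset.sum_comm]

/-- ★ **THE SAME WITH VOLUME FACTORS** (print's pairings (27) `η^d Σ_b tr(··)` on fine fields and (66) `Σ_c (L^{j}η)^d …` on block data carry constants): with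
`BE(Y, δ) = μ·Σ_i τ(Y_i δ_i)` and `B(X, X′) = ν·Σ_b τ(X_b X′_b)`, `μ ≠ 0`, the scaled transpose `(ν∕μ)•Gᵗ_V` satisfies `BE((ν∕μ)•Gᵗ_V X, δ) = B(X, G_V δ)` — the shape
`hQt`∕`hHt` of `K0Stub1SectFWSlotOneLevel.exists_sectF_W_oneLevel`. [cite: Balaban1985Variational, (27) p.282, (66) p.287] -/
theorem pair_transposeExtension_weighted (g : (ι → ℝ) →ₗ[ℝ] (κ → ℝ)) {Gv : (ι → 𝔸) →ₗ[ℂ] (κ → 𝔸)} {Gt : (κ → 𝔸) →ₗ[ℂ] (ι → 𝔸)}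
    (hGv : ∀ (A : ι → 𝔸) (b : κ), Gv A b = ∑ i, ((g (Pi.single i 1) b : ℝ) : ℂ) • A i)
    (hGt : ∀ (X : κ → 𝔸) (i : ι), Gt X i = ∑ b, ((g (Pi.single i 1) b : ℝ) : ℂ) • X b) {μ ν : ℂ} (hμ : μ ≠ 0) (X : κ → 𝔸) (δ : ι → 𝔸) :
    μ * ∑ i, τ (((ν / μ) • Gt X) i * δ i) = ν * ∑ b, τ (X b * Gv δ b) := by
  rw [← sum_pair_transposeExtension τ g hGv hGt X δ]
  simp_rw [Pi.smul_apply, smul_mul_assoc, map_smul, smul_eq_mul, ← Finset.mul_sum]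
  field_simp

end Pairing

/-! ## §3  Symmetric kernels extend to pairing-symmetric operators -/

section Symmetric

variable {ι : Type*} [Fintype ι] [DecidableEq ι]
variable {𝔸 : Type*} [Ring 𝔸] [Algebra ℂ 𝔸] (τ : 𝔸 →ₗ[ℂ] ℂ)

/-- ★ **A SYMMETRIC REAL KERNEL EXTENDS TO A PAIRING-SYMMETRIC OPERATOR**: if `g(e_i)(i′) = g(e_{i′})(i)` then `Σ_i τ((G_V X)_i X′_i) = Σ_i τ(X_i (G_V X′)_i)` — the `hM`
shape of the capstone for the multiplier `M_V` (extension of `(QGQ*)⁻¹ − a`, symmetric: UST `FlatCubeOperators.inner_EE_left`, lit-balaban `inner_aE_left`).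
[cite: Balaban1985Variational, (88) p.291; Balaban1984PropagatorsII, p.228] -/
theorem sum_pair_extension_symm (g : (ι → ℝ) →ₗ[ℝ] (ι → ℝ)) {Gv : (ι → 𝔸) →ₗ[ℂ] (ι → 𝔸)}
    (hGv : ∀ (A : ι → 𝔸) (b : ι), Gv A b = ∑ i, ((g (Pi.single i 1) b : ℝ) : ℂ) • A i)
    (hsymm : ∀ i i' : ι, g (Pi.single i 1) i' = g (Pi.single i' 1) i) (X X' : ι → 𝔸) :
    ∑ i, τ (Gv X i * X' i) = ∑ i, τ (X i * Gv X' i) := by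
  simp_rw [hGv, Finset.sum_mul, Finset.mul_sum, map_sum, smul_mul_assoc, mul_smul_comm, map_smul]
  rw [Finset.sum_comm]
  refine Finset.sum_congr rfl fun i _ => Finset.sum_congr rfl fun i' _ => ?_
  rw [hsymm]

/-- **EUCLIDEAN SYMMETRY ⇒ SYMMETRIC KERNEL**: a real operator on `ι → ℝ` whose `ℓ²` pairings are symmetric (`Σ_i (gx)_i y_i = Σ_i x_i (gy)_i` — the form in which
lit-balaban ∕ UST state the symmetry of `(QGQ*)⁻¹` and of `a` on `EuclideanSpace ℝ (BondIdx D)`, read through `WithLp`) has a symmetric kernel. [folklore] -/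
theorem kernel_symm_of_inner_symm (g : (ι → ℝ) →ₗ[ℝ] (ι → ℝ)) (hsymm : ∀ x y : ι → ℝ, ∑ i, g x i * y i = ∑ i, x i * g y i) (i i' : ι) :
    g (Pi.single i 1) i' = g (Pi.single i' 1) i := by
  have h := hsymm (Pi.single i 1) (Pi.single i' 1)
  simp only [Pi.single_apply, mul_ite, mul_one, mul_zero, Finset.sum_ite_eq', Finset.mem_univ, if_true, ite_mul, one_mul,
    zero_mul] at h
  exact h

end Symmetric

end Summit.QuantumFields.YangMills.Theorems.K0Stub1ExtensionTransposes

end
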